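import Summits.CriticalPhenomena.PercolationContinuityZ3.Theorems.PercNearOneGluingNoHeavyLowerTailStrongHarrisCubicInduction
import Summits.CriticalPhenomena.PercolationContinuityZ3.Theorems.PercNearOneGluingNoHeavyLowerTailSahiDeepCoreEGC
import Mathlib.Tactic.Linarith
import Mathlib.Tactic.Ring
import HarnessLib

/-!
# `NoHeavyLowerTail` (crux stmt-CriticalPhenomena-4575), master-family line P1 (gen 11):
# the ALL-ORDERS strong Harris–Kleitman conjecture, and the kernel links
# `all orders ⟹ S₃ ⟹ class law` and `Conjecture M (CubicSliceStep) ⟹ S₃ ⟹ class law`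

Support file (seat `prim-masterthm-p1`, gen 11; `--supports stmt-CriticalPhenomena-4575`).  One definition (the typed
conjecture `StrongHarrisAllOrders`), no `sorry`, standard axioms.  Memo
`run/shared/lean/prim/prim-masterthm/FROM-prim-masterthm-p1-g11-ALL-ORDERS.md`.

SETTING (Gladkov 2024, Thm. 2.1, as in the tree's `prodBernoulli_strongHarris`): `μ = prodBernoulli p`, cells `C i`
pairwise disjoint and disjoint from the up-set `A`, every `A ∪ C i` closed upwards, `B := (A ∪ ⋃ C i)ᶜ`.  Gladkov proves
`μ(A) μ(B) ≥ e₂(μ C)`.  The seat's conjecture S₃ (gen 10, `SahiDeepCore.strongCubic ≥ 0`; = prim-ineq-gen-4's cubic row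
`G3 = AG⁺ ≥ 0`) is the three-cell case of

  **CONJECTURE (all orders).  `μ(A) μ(B) ≥ ∏_i (1 + μ(C i)) − 1 − Σ_i μ(C i) = e₂(μC) + e₃(μC) + ⋯ + e_k(μC)`,**

equivalently `1 + μ(Aᶜ) μ(Bᶜ) ≥ ∏_i (1 + μ(C i))`; it is strongest for the FINEST admissible cells (the comparability
components of `(A ∪ B)ᶜ`) and follows for coarser ones since `1 + x + y ≤ (1 + x)(1 + y)`.  EVIDENCE (memo §1, §3): exact for
every pair (up-set `A`, down-set `B`) on ≤ 4 coordinates (7 581 systems, finest cells, all `p` — Sturm), and the much stronger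
COEFFICIENTWISE form (every coefficient of the homogenised defect in the basis `∏_j p_j^{a_j} (1−p_j)^{m−a_j}` is a
nonnegative integer) holds for all of them and for all 3-cell coarsenings (kit census on 5 coordinates: memo §3).  The
two-cell case beyond Gladkov's setting (a sixth region `(U ∪ D)ᶜ`) is PROVED in `…HarrisTwoIncomparableParts`.

KERNEL CONTENT of this file: (1) the typed conjecture (cylinder-event form, any index type); (2) its `k = 2` instance is
Gladkov/Harris (`allOrders_two`); (3) `StrongHarrisAllOrders p ⟹ strongCubic ≥ 0 ⟹` Sahi's `C₃` on the co-sunflower class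
(`strongCubic_nonneg_of_allOrders`, `classLaw_of_allOrders`, `coSunflower_nonneg_of_allOrders`); (4) the same chain from
prim-ineq-gen-4's typed Conjecture M (`StrongHarrisCubicStep.CubicSliceStep`, tree `…StrongHarrisCubicInduction`):
`CubicSliceStep p ⟹ strongCubic ≥ 0 ⟹` class law (`strongCubic_nonneg_of_cubicSliceStep`, `coSunflower_nonneg_of_cubicSliceStep`)
— so EITHER typed conjecture closes the T-row / AT₃ on the class.  HONEST FRAMING: reductions only; the conjectures are OPEN.
[this work]
-/

noncomputable section

open scoped Classical

namespace Summit.CriticalPhenomena.PercolationContinuityZ3.Theorems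

namespace AllOrdersStrongHarris

open MeasureTheory Measure Literature.Probability.Percolation Literature.Probability.LatticeModels

/-! ### 1. The typed conjecture -/

section Conjecture

variable {ι : Type*}

/-- **CONJECTURE (all-orders strong Harris–Kleitman inequality; typed).**  For `μ = prodBernoulli p` on `Set ι`: for every
finite coordinate set `F`, every `k`, every up-set `A` and cells `C : Fin k → Set (Set ι)` determined by `F`, pairwise disjoint,
disjoint from `A`, with every `A ∪ C i` closed upwards:
`∏_i (1 + μ(C i)) − 1 − Σ_i μ(C i) ≤ μ(A) · μ((A ∪ ⋃_i C i)ᶜ)`  (`= e₂ + e₃ + ⋯ + e_k` of the cell masses on the left).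
`k = 2` is Gladkov/Harris (`allOrders_two`); `k = 3` is the seat's S₃ = prim-ineq-gen-4's `G3 ≥ 0`.  Exact census: all systems
on ≤ 4 coordinates, coefficientwise on 5 (memo §1, §3).  Vacuity: for `k ≤ 1` the left side is `0`. [this work] [status: open] -/
@[conjecture] def StrongHarrisAllOrders (p : ι → unitInterval) : Prop :=
  ∀ (F : Finset ι) (k : ℕ) (A : Set (Set ι)) (C : Fin k → Set (Set ι)),
    (∀ i j, i ≠ j → Disjoint (C i) (C j)) → (∀ i, Disjoint A (C i)) →
    (∀ i, IsUpperSet (A ∪ C i)) → IsUpperSet A →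
    DeterminedBy A (↑F : Set ι) → (∀ i, DeterminedBy (C i) (↑F : Set ι)) →
    ∏ i, (1 + (prodBernoulli p).real (C i)) - 1 - ∑ i, (prodBernoulli p).real (C i) ≤
      (prodBernoulli p).real A * (prodBernoulli p).real (A ∪ ⋃ i, C i)ᶜ

/-- `⋃ i ∈ univ, C i = ⋃ i, C i` under `A ∪ ·`. [folklore] -/
theorem union_biUnion_univ {k : ℕ} (A : Set (Set ι)) (C : Fin k → Set (Set ι)) :
    (A ∪ ⋃ i ∈ (Finset.univ : Finset (Fin k)), C i) = A ∪ ⋃ i, C i := by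
  ext ω; simp

/-- **The `k = 2` instance of the conjecture holds** (it is Gladkov's Thm. 2.1 with two cells, i.e. Harris–Kleitman):
`(1 + c₀)(1 + c₁) − 1 − c₀ − c₁ = c₀ c₁ ≤ μ(A) μ(B)`. [cite: Gladkov2024StrongFKG, Thm. 2.1 (k = 2)] -/
theorem allOrders_two (p : ι → unitInterval) (F : Finset ι) (A : Set (Set ι)) (C : Fin 2 → Set (Set ι))
    (hdisj : ∀ i j, i ≠ j → Disjoint (C i) (C j)) (hdisjA : ∀ i, Disjoint A (C i))
    (hup : ∀ i, IsUpperSet (A ∪ C i)) (hA : IsUpperSet A)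
    (hAF : DeterminedBy A (↑F : Set ι)) (hCF : ∀ i, DeterminedBy (C i) (↑F : Set ι)) :
    ∏ i, (1 + (prodBernoulli p).real (C i)) - 1 - ∑ i, (prodBernoulli p).real (C i) ≤
      (prodBernoulli p).real A * (prodBernoulli p).real (A ∪ ⋃ i, C i)ᶜ := by
  have key := prodBernoulli_strongHarris_of_determinedBy p (Finset.univ : Finset (Fin 2)) F
    (fun i _ j _ hij => hdisj i j hij) (fun i _ => hdisjA i) (fun i _ => hup i) hA hAF fun i _ => hCF i
  rw [union_biUnion_univ] at key
  rw [Fin.prod_univ_two, Fin.sum_univ_two]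
  rw [Fin.sum_univ_two, Fin.sum_univ_two] at key
  nlinarith [key]

/-- **The conjecture implies Gladkov's quadratic inequality for three cells** (`e₂ ≤ e₂ + e₃`), a consistency check:
`c₀c₁ + c₀c₂ + c₁c₂ ≤ μ(A) μ(B)`. [this work] -/
theorem gladkov_three_of_allOrders (p : ι → unitInterval) (h : StrongHarrisAllOrders p) (F : Finset ι)
    (A : Set (Set ι)) (C : Fin 3 → Set (Set ι))
    (hdisj : ∀ i j, i ≠ j → Disjoint (C i) (C j)) (hdisjA : ∀ i, Disjoint A (C i))
    (hup : ∀ i, IsUpperSet (A ∪ C i)) (hA : IsUpperSet A)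
    (hAF : DeterminedBy A (↑F : Set ι)) (hCF : ∀ i, DeterminedBy (C i) (↑F : Set ι)) :
    (prodBernoulli p).real (C 0) * (prodBernoulli p).real (C 1) +
        (prodBernoulli p).real (C 0) * (prodBernoulli p).real (C 2) +
        (prodBernoulli p).real (C 1) * (prodBernoulli p).real (C 2) ≤
      (prodBernoulli p).real A * (prodBernoulli p).real (A ∪ ⋃ i, C i)ᶜ := by
  have key := h F 3 A C hdisj hdisjA hup hA hAF hCF
  rw [Fin.prod_univ_three, Fin.sum_univ_three] at key
  have h0 : 0 ≤ (prodBernoulli p).real (C 0) := measureReal_nonneg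
  have h1 : 0 ≤ (prodBernoulli p).real (C 1) := measureReal_nonneg
  have h2 : 0 ≤ (prodBernoulli p).real (C 2) := measureReal_nonneg
  nlinarith [key, mul_nonneg (mul_nonneg h0 h1) h2]

end Conjecture

/-! ### 2. Three cells: the strong cubic functional of a sandwiched triple -/

section ThreeCells

open Literature.Combinatorics.Sahi2008 StrongHarrisCubicStep
open Literature.Probability.Percolation.DecisionTree (ind)

variable {ι : Type} [Fintype ι]

local notation3 (prettyPrint := false) "m⟦" p ", " X "⟧" => ex (bernoulliWeight p) (ind X)

omit [Fintype ι] in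
/-- The Gladkov cells of a sandwiched triple `(A, B, N)` (`A ∖ B, B ∖ A ⊆ N ⊆ A ∪ B`): core `A ∩ B ∩ N`, middle cells
`A ∖ B`, `B ∖ A`, `(A ∩ B) ∖ N`, bottom `(A ∪ B)ᶜ`; the structural facts needed by Thm. 2.1. [this work] -/
theorem sandwich_cells {A B N : Set (Set ι)} (hA : IsUpperSet A) (hB : IsUpperSet B) (hN : IsUpperSet N)
    (hAB : A \ B ⊆ N) (hBA : B \ A ⊆ N) :
    let C : Fin 3 → Set (Set ι) := ![A \ B, B \ A, (A ∩ B) \ N]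
    (∀ i j, i ≠ j → Disjoint (C i) (C j)) ∧ (∀ i, Disjoint (A ∩ B ∩ N) (C i)) ∧
      (∀ i, IsUpperSet (A ∩ B ∩ N ∪ C i)) ∧ IsUpperSet (A ∩ B ∩ N) ∧
      (A ∩ B ∩ N ∪ ⋃ i, C i) = A ∪ B := by
  intro C
  have hC0 : C 0 = A \ B := rfl
  have hC1 : C 1 = B \ A := rfl
  have hC2 : C 2 = (A ∩ B) \ N := rfl
  have hK0 : A ∩ B ∩ N ∪ (A \ B) = A ∩ N := by
    ext ω; simp only [Set.mem_union, Set.mem_inter_iff, Set.mem_sdiff]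
    constructor
    · rintro (⟨⟨h1, -⟩, h3⟩ | ⟨h1, h2⟩)
      · exact ⟨h1, h3⟩
      · exact ⟨h1, hAB ⟨h1, h2⟩⟩
    · rintro ⟨h1, h3⟩
      by_cases h2 : ω ∈ B
      · exact Or.inl ⟨⟨h1, h2⟩, h3⟩
      · exact Or.inr ⟨h1, h2⟩
  have hK1 : A ∩ B ∩ N ∪ (B \ A) = B ∩ N := by
    ext ω; simp only [Set.mem_union, Set.mem_inter_iff, Set.mem_sdiff]
    constructor
    · rintro (⟨⟨-, h2⟩, h3⟩ | ⟨h2, h1⟩)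
      · exact ⟨h2, h3⟩
      · exact ⟨h2, hBA ⟨h2, h1⟩⟩
    · rintro ⟨h2, h3⟩
      by_cases h1 : ω ∈ A
      · exact Or.inl ⟨⟨h1, h2⟩, h3⟩
      · exact Or.inr ⟨h2, h1⟩
  have hK2 : A ∩ B ∩ N ∪ (A ∩ B) \ N = A ∩ B := by
    ext ω; simp only [Set.mem_union, Set.mem_inter_iff, Set.mem_sdiff]
    constructor
    · rintro (⟨h, -⟩ | ⟨h, -⟩) <;> exact h
    · intro h
      by_cases h3 : ω ∈ N
      · exact Or.inl ⟨h, h3⟩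
      · exact Or.inr ⟨h, h3⟩
  refine ⟨?_, ?_, ?_, (hA.inter hB).inter hN, ?_⟩
  · intro i j hij
    fin_cases i <;> fin_cases j
    all_goals first | exact absurd rfl hij | skip
    · exact Set.disjoint_left.2 fun ω h1 h2 => h1.2 h2.1
    · exact Set.disjoint_left.2 fun ω h1 h2 => h1.2 h2.1.2
    · exact Set.disjoint_left.2 fun ω h1 h2 => h1.2 h2.1
    · exact Set.disjoint_left.2 fun ω h1 h2 => h1.2 h2.1.1
    · exact Set.disjoint_left.2 fun ω h1 h2 => h2.2 h1.1.2
    · exact Set.disjoint_left.2 fun ω h1 h2 => h2.2 h1.1.1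
  · intro i
    fin_cases i
    · exact Set.disjoint_left.2 fun ω h1 h2 => h2.2 h1.1.2
    · exact Set.disjoint_left.2 fun ω h1 h2 => h2.2 h1.1.1
    · exact Set.disjoint_left.2 fun ω h1 h2 => h2.2 h1.2
  · intro i
    fin_cases i
    · change IsUpperSet (A ∩ B ∩ N ∪ (A \ B)); rw [hK0]; exact hA.inter hN
    · change IsUpperSet (A ∩ B ∩ N ∪ (B \ A)); rw [hK1]; exact hB.inter hN
    · change IsUpperSet (A ∩ B ∩ N ∪ (A ∩ B) \ N); rw [hK2]; exact hA.inter hB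
  · ext ω
    simp only [Set.mem_union, Set.mem_iUnion, Set.mem_inter_iff]
    constructor
    · rintro (⟨⟨h1, -⟩, -⟩ | ⟨i, hi⟩)
      · exact Or.inl h1
      · fin_cases i
        · exact Or.inl (show ω ∈ A \ B from hi).1
        · exact Or.inr (show ω ∈ B \ A from hi).1
        · exact Or.inl (show ω ∈ (A ∩ B) \ N from hi).1.1
    · intro h
      by_cases h1 : ω ∈ A
      · by_cases h2 : ω ∈ B
        · by_cases h3 : ω ∈ N
          · exact Or.inl ⟨⟨h1, h2⟩, h3⟩
          · exact Or.inr ⟨2, show ω ∈ (A ∩ B) \ N from ⟨⟨h1, h2⟩, h3⟩⟩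
        · exact Or.inr ⟨0, show ω ∈ A \ B from ⟨h1, h2⟩⟩
      · have h2 : ω ∈ B := h.resolve_left h1
        exact Or.inr ⟨1, show ω ∈ B \ A from ⟨h2, h1⟩⟩

omit [Fintype ι] in
/-- Every event on a finite index type is a cylinder event over `univ`. [folklore] -/
private theorem determinedBy_univ' [Fintype ι] (X : Set (Set ι)) :
    DeterminedBy X (↑(Finset.univ : Finset ι) : Set ι) := by
  rw [determinedBy_iff]; intro ω ω' h; simp only [Finset.coe_univ, Set.inter_univ] at h; rw [h]

/-- **All orders ⟹ S₃.**  `StrongHarrisAllOrders p` gives `strongCubic p A B N ≥ 0` (`κo ≥ e₂ + e₃` in the five cells)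
for every sandwiched increasing triple. [this work] -/
theorem strongCubic_nonneg_of_allOrders (p : ι → unitInterval) (h : StrongHarrisAllOrders p) {A B N : Set (Set ι)}
    (hA : IsUpperSet A) (hB : IsUpperSet B) (hN : IsUpperSet N) (hAB : A \ B ⊆ N) (hBA : B \ A ⊆ N) :
    0 ≤ SahiDeepCore.strongCubic p A B N := by
  obtain ⟨hdisj, hdisjA, hup, hK, hunion⟩ := sandwich_cells hA hB hN hAB hBA
  have key := h Finset.univ 3 (A ∩ B ∩ N) ![A \ B, B \ A, (A ∩ B) \ N] hdisj hdisjA hup hK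
    (determinedBy_univ' _) fun i => determinedBy_univ' _
  rw [hunion, Fin.prod_univ_three, Fin.sum_univ_three] at key
  simp only [Matrix.cons_val_zero, Matrix.cons_val_one, Matrix.cons_val] at key
  simp only [SahiDeepCore.strongCubic, ex_bernoulliWeight_ind]
  nlinarith [key]

/-- **All orders ⟹ the co-sunflower class law** (Sahi's `C₃` for every sandwiched increasing triple; via `E₃ ≥ F_S`,
tree `sahiE_three_ge_strongCubic`). [this work] -/
theorem classLaw_of_allOrders (p : ι → unitInterval) (h : StrongHarrisAllOrders p) {A B N : Set (Set ι)}
    (hA : IsUpperSet A) (hB : IsUpperSet B) (hN : IsUpperSet N) (hAB : A \ B ⊆ N) (hBA : B \ A ⊆ N)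
    (hNs : N ⊆ A ∪ B) : 0 ≤ sahiE (bernoulliWeight p) 3 ![ind A, ind B, ind N] :=
  le_trans (strongCubic_nonneg_of_allOrders p h hA hB hN hAB hBA)
    (SahiDeepCore.sahiE_three_ge_strongCubic p hA hB hN hAB hBA hNs)

/-- **All orders ⟹ `E₃(G₂∪G₃, G₁∪G₃, G₁∪G₂) ≥ 0`** for all increasing `G_i` (the T-row / AT₃ on the class). [this work] -/
theorem coSunflower_nonneg_of_allOrders (p : ι → unitInterval) (h : StrongHarrisAllOrders p) {G₁ G₂ G₃ : Set (Set ι)}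
    (h₁ : IsUpperSet G₁) (h₂ : IsUpperSet G₂) (h₃ : IsUpperSet G₃) :
    0 ≤ sahiE (bernoulliWeight p) 3 ![ind (G₂ ∪ G₃), ind (G₁ ∪ G₃), ind (G₁ ∪ G₂)] := by
  obtain ⟨s1, s2, s3⟩ := SahiDeepCore.coSunflower_sandwich G₁ G₂ G₃
  exact classLaw_of_allOrders p h (h₂.union h₃) (h₁.union h₃) (h₁.union h₂) s1 s2 s3

/-! ### 3. Conjecture M (prim-ineq-gen-4's `CubicSliceStep`) closes the same chain -/

/-- **Conjecture M ⟹ S₃.**  `CubicSliceStep p` (tree `…StrongHarrisCubicInduction`, giving `G3 ≥ 0` for every 3-cell Gladkov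
system) yields `strongCubic p A B N ≥ 0` for every sandwiched increasing triple: `strongCubic` IS `G3` of the cells
`(A ∩ B ∩ N; A ∖ B, B ∖ A, (A ∩ B) ∖ N; (A ∪ B)ᶜ)`. [this work] -/
theorem strongCubic_nonneg_of_cubicSliceStep (p : ι → unitInterval) (hM : CubicSliceStep p) {A B N : Set (Set ι)}
    (hA : IsUpperSet A) (hB : IsUpperSet B) (hN : IsUpperSet N) (hAB : A \ B ⊆ N) (hBA : B \ A ⊆ N) :
    0 ≤ SahiDeepCore.strongCubic p A B N := by
  obtain ⟨hdisj, hdisjA, hup, hK, hunion⟩ := sandwich_cells hA hB hN hAB hBA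
  have key := prodBernoulli_strongHarris_cubic_of_sliceStep p hM (A := A ∩ B ∩ N)
    (C := ![A \ B, B \ A, (A ∩ B) \ N]) hdisj hdisjA hup hK
  rw [hunion] at key
  simp only [G3, Matrix.cons_val_zero, Matrix.cons_val_one, Matrix.cons_val] at key
  simp only [SahiDeepCore.strongCubic, ex_bernoulliWeight_ind]
  linarith [key]

/-- **Conjecture M ⟹ the co-sunflower class law** (Sahi's `C₃` for sandwiched increasing triples). [this work] -/
theorem classLaw_of_cubicSliceStep (p : ι → unitInterval) (hM : CubicSliceStep p) {A B N : Set (Set ι)}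
    (hA : IsUpperSet A) (hB : IsUpperSet B) (hN : IsUpperSet N) (hAB : A \ B ⊆ N) (hBA : B \ A ⊆ N)
    (hNs : N ⊆ A ∪ B) : 0 ≤ sahiE (bernoulliWeight p) 3 ![ind A, ind B, ind N] :=
  le_trans (strongCubic_nonneg_of_cubicSliceStep p hM hA hB hN hAB hBA)
    (SahiDeepCore.sahiE_three_ge_strongCubic p hA hB hN hAB hBA hNs)

/-- **Conjecture M ⟹ `E₃(G₂∪G₃, G₁∪G₃, G₁∪G₂) ≥ 0`** for all increasing `G_i`. [this work] -/
theorem coSunflower_nonneg_of_cubicSliceStep (p : ι → unitInterval) (hM : CubicSliceStep p)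
    {G₁ G₂ G₃ : Set (Set ι)} (h₁ : IsUpperSet G₁) (h₂ : IsUpperSet G₂) (h₃ : IsUpperSet G₃) :
    0 ≤ sahiE (bernoulliWeight p) 3 ![ind (G₂ ∪ G₃), ind (G₁ ∪ G₃), ind (G₁ ∪ G₂)] := by
  obtain ⟨s1, s2, s3⟩ := SahiDeepCore.coSunflower_sandwich G₁ G₂ G₃
  exact classLaw_of_cubicSliceStep p hM (h₂.union h₃) (h₁.union h₃) (h₁.union h₂) s1 s2 s3

end ThreeCells

end AllOrdersStrongHarris

end Summit.CriticalPhenomena.PercolationContinuityZ3.Theorems
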